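import Summits.BirchSwinnertonDyer.Rank1Residual.O5.O5KummerLine
import Summits.BirchSwinnertonDyer.Rank1Residual.GaloisImage.PsiThreeKummerQuarticShapes
import Summits.BirchSwinnertonDyer.Rank1Residual.GaloisImage.PsiThreeRootlessShapesThree
import Summits.BirchSwinnertonDyer.Rank1Residual.Additive.KodairaDictionaryThree
import Literature.NumberTheory.DiophantineGeometry.TateAlgorithmRingEquivProofs
import Literature.NumberTheory.EllipticCurves.NeronComponentIndexTypeIIIstarProofs
import Literature.NumberTheory.EllipticCurves.ModularityVersionApProofs
import HarnessLib

/-!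
# T19a `O5.SupersingularLocalClassUniqueThree` HOLDS: one local projective `3`-torsion class at `3`
# (cell `b2b-bsdres`, team n1011, row T-SSQ3, seat n1011-p05 GEN 11, FILE F3b — END)

HONEST FRAMING (cell `b2b-bsdres`, run/shared/lean/b2b/bsd-rank1-residual/, verbatim in every
file): the goal of the cell is to DELETE the COMBINATION-SHAPED residual classes of the
Birch–Swinnerton-Dyer formula for ALL analytic-rank `≤ 1` elliptic curves over `ℚ` — "full BSD
formula for every rank `≤ 1` curve in class `C`" assembled STRICTLY from published theorems — so
that the rank-`≤ 1` remainder becomes exactly the CONSTRUCTION-SHAPED classes, which are TYPED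
(missing-input `Prop`s), NOT attempted. This is not "finishing BSD". Team n1011; row T-SSQ3
(`cells/n1011/skel/T-SSQ3.md`). This file PROVES, AS TYPED, the O5 cell's `@[conjecture]`-tagged
THEOREM-CANDIDATE T19a `O5.SupersingularLocalClassUniqueThree` (o5-r1 GEN 5 G5-4, typed by
cc-typer-5 in `O5/O5KummerLine.lean`; "tag kept until a KERNEL proof"). The node's definition is
IMPORTED BY NAME and untouched; an `@[conjecture]` node becomes a theorem — it closes NO pair, moves NO
mark (O5 OPEN); theorems only; nothing booked.

## What is proved, and how

`O5.supersingularLocalClassUniqueThree_holds : SupersingularLocalClassUniqueThree` — for `E, E'/ℚ`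
globally minimal, each `(ClassO5 · 3 ∧ SubTprime · 3 ∧ v₃Δ = 9)` (Kodaira `III*`) or `3 ∤ N` (good
at `3`), both with `Ψ₃` rootless over `ℚ₃` (`E[3]|G_{ℚ₃}` irreducible):
`SameDivisionQuarticAtThree E E'`.

ROUTE (elementary; NOT the `V₀ = Ind(ω₂μ₋₁)` / `SD₁₆` route of the node's docstring — no Galois
representation enters): **`ℚ₃(x(P)) ≅ K₄ = ℚ₃(3^{1/4})` for every admissible curve.**
* §1 (G) `kummerShape_of_not_dvd_conductorNorm`: `3 ∤ N` ⟹ the `ℤ₃`-minimal model `M₀` has unit `Δ`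
  (Mathlib `HasGoodReduction`, tree `dvd_conductorNorm_iff_not_hasGoodReductionAtPrime`); rootless
  ⟹ `3 ∣ b₂` ⟹ `b₈ ≡ −1 (mod 3)` (F3a, Hensel in `ℤ₃` / a `ℤ/3` computation); the reversed `Ψ₃` is
  Eisenstein, `Ψ₃` irreducible with a root in `K₄` (F2b); transported back to `E ⊗ ℚ₃` along the
  minimising change of model (F2a).
* §2 (T) `kummerShape_of_IIIstar`: `SubTprime ∧ v₃Δ = 9` ⟹ Kodaira `III*` at `placeOf 3`
  (`subTprime_three_iff_kodairaSymbolAt_III_or_IIIstar` + Ogg: `III` would give `v₃Δ = 3`) ⟹ over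
  `ℤ₃` (`kodairaSymbolAt_eq_padic`) Tate's normal form `3∣a₁, 9∣a₂, 27∣a₃, 27∥a₄, 3⁵∣a₆` (tree
  `exists_smul_of_kodairaSymbolOfMinimal_eq_IIIstar`); rootless ⟹ `27 ∣ b₂` (F3a); `Ψ₃(3t)/3⁵`
  Eisenstein, `Ψ₃` irreducible with the root `3ϖζ ∈ K₄` (F2b); transported back (F2a).
* §3 END: `AdjoinRoot Ψ₃^E ≅ K₄` by dimension (F1 `exists_aeval_eq_zero_of_roots_in_kummerField`), so
  `Ψ₃^{E'}` has a root in `ℚ₃[X]/(Ψ₃^E)`.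

Binder honesty: every binder of the node is consumed as typed (`ClassO5 → Addv` feeds the Kodaira
dictionary; `SubTameSS` is carried, not needed); no hypothesis added or dropped; 0 defs / 0 facts.

References: J.-P. Serre, Invent. Math. 15 (1972) §1.11 Prop. 12 (motivation: `E[3]|I₃` at a
supersingular `3`) [Serre1972]; J. H. Silverman, *AEC* VII.1, VII.5 [SilvermanAEC2009]; *ATAEC*
IV.9.4 Steps 6–9, Table 4.1 [SilvermanATAEC1994]; J. Tate, *Algorithm …* (1975) [Tate1975];
cells/n1011/skel/T-SSQ3.md (240ef752a75a0f71).
-/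

noncomputable section

open scoped Classical

open Polynomial WeierstrassCurve IsDedekindDomain IsDedekindDomain.HeightOneSpectrum NumberField
  Literature.NumberTheory.DiophantineGeometry Literature.NumberTheory.DiophantineGeometry.TateAlgorithm
  Literature.NumberTheory.EllipticCurves Literature.NumberTheory.EllipticCurves.LocalIndex
  Summit.BirchSwinnertonDyer.Rank1Residual.Additive
  Summit.BirchSwinnertonDyer.Rank1Residual.GaloisImage.QuarticKummerThree
  Summit.BirchSwinnertonDyer.Rank1Residual.GaloisImage.PsiThreeKummer

namespace Summit.BirchSwinnertonDyer.Rank1Residual.O5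

variable (E : WeierstrassCurve ℚ) [E.IsElliptic] [E.IsGloballyMinimal]

/-! ## §0 Transport along the minimising change of model over `ℚ₃` -/

omit [E.IsElliptic] [E.IsGloballyMinimal] in
/-- **Transport of the Kummer shape back to the given model**: if `C • (E ⊗ ℚ₃) = M ⊗ ℚ₃` for a
`ℤ₃`-model `M` whose `Ψ₃` is irreducible over `ℚ₃` with a root in `K₄`, the same holds for `E ⊗ ℚ₃`
(F2a `irreducible_Ψ₃_smul_iff`, `aeval_Ψ₃_eq_zero_of_smul`). [folklore] -/
theorem kummerShape_of_smul_eq_map {C : VariableChange ℚ_[3]} {M : WeierstrassCurve ℤ_[3]}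
    (hCM : C • E.baseChange ℚ_[3] = M.map (algebraMap ℤ_[3] ℚ_[3]))
    (hirr : Irreducible (M.map (algebraMap ℤ_[3] ℚ_[3])).Ψ₃)
    (hx : ∃ x : AdjoinRoot (X ^ 4 - Polynomial.C (3 : ℚ_[3])),
      aeval x (M.map (algebraMap ℤ_[3] ℚ_[3])).Ψ₃ = 0) :
    Irreducible (E.baseChange ℚ_[3]).Ψ₃ ∧
      ∃ x : AdjoinRoot (X ^ 4 - Polynomial.C (3 : ℚ_[3])), aeval x (E.baseChange ℚ_[3]).Ψ₃ = 0 := by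
  rw [← hCM] at hirr hx
  obtain ⟨x, hx⟩ := hx
  exact ⟨(irreducible_Ψ₃_smul_iff (E.baseChange ℚ_[3]) C).mp hirr,
    ⟨_, aeval_Ψ₃_eq_zero_of_smul (E.baseChange ℚ_[3]) C hx⟩⟩

omit [E.IsElliptic] [E.IsGloballyMinimal] in
/-- Rootlessness of `Ψ₃` passes from `E ⊗ ℚ₃` to any `ℚ₃`-isomorphic model (F2a). [folklore] -/
theorem forall_not_isRoot_of_smul_eq_map {C : VariableChange ℚ_[3]} {M : WeierstrassCurve ℤ_[3]}
    (hCM : C • E.baseChange ℚ_[3] = M.map (algebraMap ℤ_[3] ℚ_[3]))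
    (hroot : ∀ r : ℚ_[3], ¬ ((E.baseChange ℚ_[3]).Ψ₃).IsRoot r) :
    ∀ r : ℚ_[3], ¬ ((M.map (algebraMap ℤ_[3] ℚ_[3])).Ψ₃).IsRoot r := by
  rw [← hCM]
  exact (forall_not_isRoot_Ψ₃_smul_iff (E.baseChange ℚ_[3]) C).mpr hroot

omit [E.IsElliptic] [E.IsGloballyMinimal] in
/-- The `ℤ₃`-minimal model: `C₀ • (E ⊗ ℚ₃) = M₀ ⊗ ℚ₃` with `M₀` the integral model of Mathlib's chosen
minimal equation (Silverman *AEC* VII.1). [cite: SilvermanAEC2009, VII.1 Prop. 1.3] -/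
theorem exists_smul_eq_map_minimal :
    ∃ C₀ : VariableChange ℚ_[3],
      C₀ • E.baseChange ℚ_[3] =
        (((E.baseChange ℚ_[3]).minimal ℤ_[3]).integralModel ℤ_[3]).map (algebraMap ℤ_[3] ℚ_[3]) := by
  refine ⟨((E.baseChange ℚ_[3]).exists_isMinimal ℤ_[3]).choose, ?_⟩
  exact (baseChange_integralModel_eq ℤ_[3] ((E.baseChange ℚ_[3]).minimal ℤ_[3])).symm

/-! ## §1 (G) good reduction at `3` -/

omit [E.IsGloballyMinimal] in
/-- **(G) At a good `3` with `Ψ₃` rootless over `ℚ₃`: `Ψ₃^E` is irreducible over `ℚ₃` and has a root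
in `K₄ = ℚ₃(3^{1/4})`.** The `ℤ₃`-minimal model has unit discriminant; rootless ⟹ `3 ∣ b₂`
(supersingular) ⟹ `b₈ ≡ −1 (mod 3)`; then the good supersingular shape of F2b applies.
[cite: SilvermanAEC2009, VII.5 Prop. 5.1 (good reduction: unit discriminant of a minimal model)] -/
theorem kummerShape_of_not_dvd_conductorNorm (hN : ¬ (3 ∣ E.conductorNorm ℤ))
    (hroot : ∀ r : ℚ_[3], ¬ ((E.baseChange ℚ_[3]).Ψ₃).IsRoot r) :
    Irreducible (E.baseChange ℚ_[3]).Ψ₃ ∧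
      ∃ x : AdjoinRoot (X ^ 4 - Polynomial.C (3 : ℚ_[3])), aeval x (E.baseChange ℚ_[3]).Ψ₃ = 0 := by
  haveI : Fact (Nat.Prime 3) := ⟨Nat.prime_three⟩
  have hgood : E.HasGoodReductionAtPrime 3 := by
    by_contra hng
    exact hN ((E.dvd_conductorNorm_iff_not_hasGoodReductionAtPrime 3).mpr hng)
  -- the minimal `ℤ₃`-model and its unit discriminant
  haveI hg : ((E.baseChange ℚ_[3]).minimal ℤ_[3]).HasGoodReduction ℤ_[3] := hgood
  set M₀ := ((E.baseChange ℚ_[3]).minimal ℤ_[3]).integralModel ℤ_[3] with hM₀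
  obtain ⟨C₀, hC₀⟩ := exists_smul_eq_map_minimal E
  have hΔ : IsUnit M₀.Δ := by
    have hell := (hasGoodReduction_iff_isElliptic_reduction (R := ℤ_[3])
      (W := (E.baseChange ℚ_[3]).minimal ℤ_[3])).mp hg
    have hu : IsUnit (((E.baseChange ℚ_[3]).minimal ℤ_[3]).reduction ℤ_[3]).Δ := by
      haveI := hell
      exact (((E.baseChange ℚ_[3]).minimal ℤ_[3]).reduction ℤ_[3]).isUnit_Δ
    rw [WeierstrassCurve.reduction, map_Δ, ← hM₀] at hu
    by_contra hnu
    have hmem : M₀.Δ ∈ IsLocalRing.maximalIdeal ℤ_[3] := (IsLocalRing.mem_maximalIdeal _).mpr hnu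
    rw [← IsLocalRing.residue_eq_zero_iff] at hmem
    rw [hmem] at hu
    exact not_isUnit_zero hu
  have hroot₀ := forall_not_isRoot_of_smul_eq_map E hC₀ hroot
  have h2 := three_dvd_b₂_of_forall_not_isRoot M₀ hroot₀
  have h8 := three_dvd_b₈_add_one M₀ h2 hΔ
  exact kummerShape_of_smul_eq_map E hC₀ (irreducible_Ψ₃_of_goodShape M₀ h2 h8)
    (exists_kummerRoot_Ψ₃_of_goodShape M₀ h2 h8)

/-! ## §2 (T) Kodaira `III*` at `3` -/

/-- `𝔪_{ℤ₃}^k`-membership is divisibility by `3^k`. [folklore] -/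
theorem pow_dvd_of_mem_maximalIdeal_pow {a : ℤ_[3]} {k : ℕ}
    (h : a ∈ IsLocalRing.maximalIdeal ℤ_[3] ^ k) : (3 : ℤ_[3]) ^ k ∣ a := by
  haveI : Fact (Nat.Prime 3) := ⟨Nat.prime_three⟩
  rw [PadicInt.maximalIdeal_eq_span_p, Ideal.span_singleton_pow, Ideal.mem_span_singleton] at h
  exact_mod_cast h

/-- Divisibility by `3^k` is `𝔪_{ℤ₃}^k`-membership. [folklore] -/
theorem mem_maximalIdeal_pow_of_pow_dvd {a : ℤ_[3]} {k : ℕ} (h : (3 : ℤ_[3]) ^ k ∣ a) :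
    a ∈ IsLocalRing.maximalIdeal ℤ_[3] ^ k := by
  haveI : Fact (Nat.Prime 3) := ⟨Nat.prime_three⟩
  rw [PadicInt.maximalIdeal_eq_span_p, Ideal.span_singleton_pow, Ideal.mem_span_singleton]
  exact_mod_cast h

/-- **On `SubTprime ∧ v₃(Δ) = 9` the Kodaira symbol at `3` is `III*`** (`SubTprime ⟺ III ∨ III*`;
Ogg's `v₃(Δ_min) = m + 1` gives `3` for `III`, `9` for `III*`; `Δ = Δ_min` on a globally minimal
model). [cite: SilvermanATAEC1994, IV.9.4 Steps 4, 9 and Table 4.1] -/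
theorem kodairaSymbolAt_eq_IIIstar_of_subTprime_of_padicValRat [Fact (Nat.Prime 3)] (h5 : ClassO5 E 3)
    (ht : SubTprime E 3) (h9 : padicValRat 3 E.Δ = 9) :
    E.kodairaSymbolAt (placeOf 3) = .IIIstar := by
  haveI : PerfectField (IsLocalRing.ResidueField ((placeOf 3).adicCompletionIntegers ℚ)) :=
    PerfectField.ofFinite
  have hIII := (subTprime_three_iff_kodairaSymbolAt_III_or_IIIstar E h5.2.1).mp ht
  rcases hIII with h | h
  · exfalso
    have h2 : ringChar (ℤ ⧸ (placeOf 3).asIdeal) ≠ 2 := by rw [ringChar_int_quot_placeOf 3]; decide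
    have hord := E.ordMinimalDiscriminant_eq_numComponentsAt_add_one_of_kodairaSymbolAt (placeOf 3) h2
      (Or.inl h)
    rw [ordMinimalDiscriminant_placeOf_eq E 3] at hord
    unfold numComponentsAt at hord
    rw [h] at hord
    simp only [KodairaSymbol.numComponents] at hord
    have hv : padicValInt 3 E.minimalDiscriminantInt = 9 := by
      have := cast_minimalDiscriminantInt E
      rw [← this, padicValRat.of_int] at h9
      exact_mod_cast h9
    omega
  · exact h

omit [E.IsGloballyMinimal] in
/-- **Tate's normal form of type `III*` over `ℤ₃` for `E`**: a change of model `C` over `ℚ₃` and a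
`ℤ₃`-model `J` with `C • (E ⊗ ℚ₃) = J ⊗ ℚ₃`, `a₁ = 3α₁, a₂ = 9α₂, a₃ = 27α₃, a₄ = 27α₄` with `α₄` a
unit, `a₆ = 243α₆` (tree `exists_smul_of_kodairaSymbolOfMinimal_eq_IIIstar` on the `ℤ₃`-minimal model,
Kodaira symbol transported by `kodairaSymbolAt_eq_padic`).
[cite: SilvermanATAEC1994, IV.9.4 Steps 6–9 (PDF pp. 344–346)] -/
theorem exists_IIIstarForm [Fact (Nat.Prime 3)] (hK : E.kodairaSymbolAt (placeOf 3) = .IIIstar) :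
    ∃ (C : VariableChange ℚ_[3]) (J : WeierstrassCurve ℤ_[3]) (α₁ α₂ α₃ α₄ α₆ : ℤ_[3]),
      C • E.baseChange ℚ_[3] = J.map (algebraMap ℤ_[3] ℚ_[3]) ∧
      J.a₁ = 3 * α₁ ∧ J.a₂ = 9 * α₂ ∧ J.a₃ = 27 * α₃ ∧ J.a₄ = 27 * α₄ ∧ IsUnit α₄ ∧
      J.a₆ = 243 * α₆ := by
  haveI : Finite (IsLocalRing.ResidueField ℤ_[3]) :=
    Finite.of_equiv _ (PadicInt.residueField (p := 3)).toEquiv.symm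
  haveI : PerfectField (IsLocalRing.ResidueField ℤ_[3]) := PerfectField.ofFinite
  -- the Kodaira symbol over `ℤ₃`
  have hq : Rat.HeightOneSpectrum.primesEquiv (R := ℤ) (placeOf 3) = ⟨3, Nat.prime_three⟩ :=
    (Rat.HeightOneSpectrum.primesEquiv (R := ℤ)).apply_symm_apply ⟨3, Nat.prime_three⟩
  have key : ∀ q : Nat.Primes, q = ⟨3, Nat.prime_three⟩ →
      (haveI : Fact q.1.Prime := ⟨q.2⟩
       (E.baseChange ℚ_[q]).kodairaSymbol ℤ_[q] = .IIIstar) →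
      (E.baseChange ℚ_[3]).kodairaSymbol ℤ_[3] = .IIIstar := by
    rintro _ rfl h; exact h
  have hpadic : (E.baseChange ℚ_[3]).kodairaSymbol ℤ_[3] = .IIIstar := by
    refine key _ hq ?_
    rw [← kodairaSymbolAt_eq_padic (placeOf 3) E]
    exact hK
  -- Tate's normal form on the minimal `ℤ₃`-model
  set M₀ := ((E.baseChange ℚ_[3]).minimal ℤ_[3]).integralModel ℤ_[3] with hM₀
  have hKM : M₀.kodairaSymbolOfMinimal = .IIIstar := hpadic
  obtain ⟨D, h1, h2, h3, h4, h4', h6⟩ := exists_smul_of_kodairaSymbolOfMinimal_eq_IIIstar M₀ hKM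
  obtain ⟨C₀, hC₀⟩ := exists_smul_eq_map_minimal E
  obtain ⟨α₁, hα₁⟩ := pow_dvd_of_mem_maximalIdeal_pow (k := 1) (a := (D • M₀).a₁) (by rwa [pow_one])
  obtain ⟨α₂, hα₂⟩ := pow_dvd_of_mem_maximalIdeal_pow h2
  obtain ⟨α₃, hα₃⟩ := pow_dvd_of_mem_maximalIdeal_pow h3
  obtain ⟨α₄, hα₄⟩ := pow_dvd_of_mem_maximalIdeal_pow h4
  obtain ⟨α₆, hα₆⟩ := pow_dvd_of_mem_maximalIdeal_pow h6
  have hα₄u : IsUnit α₄ := by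
    rw [isUnit_iff_not_three_dvd]
    rintro ⟨c, hc⟩
    refine h4' (mem_maximalIdeal_pow_of_pow_dvd ⟨c, ?_⟩)
    rw [hα₄, hc]; ring
  refine ⟨D.map (algebraMap ℤ_[3] ℚ_[3]) * C₀, D • M₀, α₁, α₂, α₃, α₄, α₆, ?_,
    by rw [hα₁]; ring, by rw [hα₂]; ring, by rw [hα₃]; ring, by rw [hα₄]; ring, hα₄u,
    by rw [hα₆]; ring⟩
  rw [mul_smul, hC₀, map_variableChange]

omit [E.IsGloballyMinimal] in
/-- **(T) At a place of Kodaira type `III*` with `Ψ₃` rootless over `ℚ₃`: `Ψ₃^E` is irreducible over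
`ℚ₃` and has a root in `K₄ = ℚ₃(3^{1/4})`.** On Tate's form `b₂ = 9β`, `b₄ = 27β₄`, `b₆ = 243β₆'`,
`b₈ = 729β₈` with `3 ∣ β₈ + 1` (F3a); rootless ⟹ `3 ∣ β` (F3a, Hensel); then the `III*` shape of F2b
applies, and the conclusion transports back (F2a). [cite: SilvermanATAEC1994, IV.9.4 Step 9] -/
theorem kummerShape_of_kodairaSymbolAt_IIIstar [Fact (Nat.Prime 3)]
    (hK : E.kodairaSymbolAt (placeOf 3) = .IIIstar)
    (hroot : ∀ r : ℚ_[3], ¬ ((E.baseChange ℚ_[3]).Ψ₃).IsRoot r) :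
    Irreducible (E.baseChange ℚ_[3]).Ψ₃ ∧
      ∃ x : AdjoinRoot (X ^ 4 - Polynomial.C (3 : ℚ_[3])), aeval x (E.baseChange ℚ_[3]).Ψ₃ = 0 := by
  obtain ⟨C, J, α₁, α₂, α₃, α₄, α₆, hCJ, ha₁, ha₂, ha₃, ha₄, hα₄, ha₆⟩ := exists_IIIstarForm E hK
  have hrootJ := forall_not_isRoot_of_smul_eq_map E hCJ hroot
  -- the `b`'s of Tate's form
  have hb₂ : J.b₂ = 9 * (α₁ ^ 2 + 4 * α₂) := IIIstarForm.b₂_eq J ha₁ ha₂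
  have hb₄ : J.b₄ = 27 * (2 * α₄ + 3 * α₁ * α₃) := IIIstarForm.b₄_eq J ha₁ ha₃ ha₄
  have hb₆ : J.b₆ = 81 * (9 * α₃ ^ 2 + 12 * α₆) := IIIstarForm.b₆_eq J ha₃ ha₆
  have hb₆' : J.b₆ = 243 * (3 * α₃ ^ 2 + 4 * α₆) := by rw [hb₆]; ring
  have hb₈ : J.b₈ =
      729 * (3 * α₁ ^ 2 * α₆ + 12 * α₂ * α₆ - 3 * α₁ * α₃ * α₄ + 9 * α₂ * α₃ ^ 2 - α₄ ^ 2) :=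
    IIIstarForm.b₈_eq J ha₁ ha₂ ha₃ ha₄ ha₆
  have hβ₈ := IIIstarForm.three_dvd_β₈_add_one (α₁ := α₁) (α₂ := α₂) (α₃ := α₃) (α₆ := α₆) hα₄
  -- rootless ⟹ `27 ∣ b₂`
  obtain ⟨β₂, hβ₂⟩ := three_dvd_of_IIIstarShape_of_forall_not_isRoot J hb₂ hb₄ hb₆' hb₈ hrootJ
  have hb₂' : J.b₂ = 27 * β₂ := by rw [hb₂, hβ₂]; ring
  exact kummerShape_of_smul_eq_map E hCJ (irreducible_Ψ₃_of_IIIstarShape J hb₂' hb₄ hb₆ hb₈ hβ₈)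
    (exists_kummerRoot_Ψ₃_of_IIIstarShape J hb₂' hb₄ hb₆ hb₈ hβ₈)

/-- **(T) On `ClassO5 ∧ SubTprime ∧ v₃(Δ) = 9` (the `III*` clause of T19a) with `Ψ₃` rootless over
`ℚ₃`: `Ψ₃^E` is irreducible over `ℚ₃` and has a root in `K₄`.** [cite: SilvermanATAEC1994, IV.9.4 Step 9] -/
theorem kummerShape_of_IIIstar (h5 : ClassO5 E 3) (ht : SubTprime E 3) (h9 : padicValRat 3 E.Δ = 9)
    (hroot : ∀ r : ℚ_[3], ¬ ((E.baseChange ℚ_[3]).Ψ₃).IsRoot r) :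
    Irreducible (E.baseChange ℚ_[3]).Ψ₃ ∧
      ∃ x : AdjoinRoot (X ^ 4 - Polynomial.C (3 : ℚ_[3])), aeval x (E.baseChange ℚ_[3]).Ψ₃ = 0 := by
  haveI : Fact (Nat.Prime 3) := ⟨Nat.prime_three⟩
  exact kummerShape_of_kodairaSymbolAt_IIIstar E
    (kodairaSymbolAt_eq_IIIstar_of_subTprime_of_padicValRat E h5 ht h9) hroot

/-! ## §3 END — T19a holds -/

/-- **Per curve**: on either admissible class, with `Ψ₃` rootless over `ℚ₃`, `Ψ₃^E` is irreducible over
`ℚ₃` and has a root in `K₄ = ℚ₃(3^{1/4})` — `ℚ₃(x(P)) ≅ ℚ₃(3^{1/4})`. [folklore] -/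
theorem kummerShape_of_cases
    (hE : (ClassO5 E 3 ∧ SubTprime E 3 ∧ padicValRat 3 E.Δ = 9) ∨ ¬ (3 ∣ E.conductorNorm ℤ))
    (hroot : ∀ r : ℚ_[3], ¬ ((E.baseChange ℚ_[3]).Ψ₃).IsRoot r) :
    Irreducible (E.baseChange ℚ_[3]).Ψ₃ ∧
      ∃ x : AdjoinRoot (X ^ 4 - Polynomial.C (3 : ℚ_[3])), aeval x (E.baseChange ℚ_[3]).Ψ₃ = 0 := by
  rcases hE with ⟨h5, ht, h9⟩ | hN
  · exact kummerShape_of_IIIstar E h5 ht h9 hroot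
  · exact kummerShape_of_not_dvd_conductorNorm E hN hroot

/-- **T19a `SupersingularLocalClassUniqueThree` HOLDS** (o5-r1 GEN 5 G5-4 / cc-typer-5,
`O5/O5KummerLine.lean`): ONE local class at `3` — any two curves over `ℚ`, each good at `3` or a
`III*` O5b curve, both with `Ψ₃` rootless over `ℚ₃`, are locally twin at `3`: `Ψ₃^E` is irreducible over
`ℚ₃` and `Ψ₃^{E'}` has a root in `ℚ₃[X]/(Ψ₃^E)` — because both quartics cut out `ℚ₃(3^{1/4})`.
[cite: Serre1972, §1.11 Prop. 12 (motivation)] [cite: SilvermanATAEC1994, IV.9.4 Step 9] -/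
theorem supersingularLocalClassUniqueThree_holds : SupersingularLocalClassUniqueThree := by
  intro E E' _ _ _ _ hE hE' hr hr'
  obtain ⟨hirr, x, hx⟩ := kummerShape_of_cases E hE hr
  obtain ⟨-, x', hx'⟩ := kummerShape_of_cases E' hE' hr'
  exact ⟨hirr, exists_aeval_eq_zero_of_roots_in_kummerField hirr
    ((E.baseChange ℚ_[3]).natDegree_Ψ₃ (by norm_num)) hx hx'⟩

end Summit.BirchSwinnertonDyer.Rank1Residual.O5

end
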